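import Summits.CriticalPhenomena.PercolationContinuityZ3.Theorems.PercNearOneGluingNoHeavyLowerTailKnQuestion8PocketSetDual
import Summits.CriticalPhenomena.PercolationContinuityZ3.Theorems.PercNearOneGluingNoHeavyLowerTailKnQuestion8PocketSetAttach
import HarnessLib

/-!
# Kozma–Nitzan's Question 8 / MC-D for three relays — ASSEMBLY: (41) at the pocket-designated relay from the pocket covariance
# comparisons PCOV / PCOV⁺ ALONE (the weak-relay part (Z*D) is no longer an input)

Support file (`--supports stmt-CriticalPhenomena-4575`, closed), prover `prim-lf-2` (gen 17).  No definitions, no named facts,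
no sorries; standard axioms.  Memo `prim-lf-2/POCKET-SETDUAL-gen17.md`.  This file wires
`PocketCert.attach_of_pocket_union` ((BHK-D⁺), proved) → `PocketCert.p1star_pocket_of_pieces` ((P1*D⁺) = t·PCOV⁺ + (1−t)·(BHK-D⁺))
→ `PocketCert.zpart_of_setHalves` ((Z*D) by duality through the set clusters `C x ∪ C o`, `C y ∪ C o`) →
`PocketCert.block41_three_of_pcov` ((41)) into ONE statement whose only substantive hypotheses are pocket covariance comparisons:
  PCOV_x  : `b·(mDE1·IDFx − mDFx·IDE1) ≤ mDE2·((mDE1+mDFx)·(IxoE1+IxoF) − (a+d)·(IDE1+IDFx))` at `G = 1{b ∈ ·}` (owner functional `G(C x)`),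
  PCOV⁺_x : the same inequality for EVERY monotone `G`, with `G(C x ∪ C o)` in the pocket integrals `IDE1, IDFx` and `G(C x)` in the
            observer integrals `IxoE1, IxoF`,
  PCOV_y, PCOV⁺_y : the same with `x ↔ y`,
for a pocket family `𝒟` (down-closed vertex sets avoiding `x, y, z`; `P = {C_o ∈ 𝒟}`; Question 8: all such sets, Question 9: `{W ⊆ {o}}`),
the certificate point `(t, λ, μ)` of `block41_three_of_pcov` and the pocket designation `μ(P ∩ {z↔b}) ≤ μ(P ∩ {x↔b}), μ(P ∩ {y↔b})`:
* `PocketCert.block41_three_of_pcovSet` — then `μ({z↔b} ∩ {o↔A}) ≤ μ({o↔b} ∩ {o↔A})`, `A = {x,y,z}`.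
So Kozma–Nitzan's Question 8 at `|A| = 3` (and prim-lf-2's MC-D@3 for every pocket family) is reduced in the tree to ONE TYPE of
inequality — the pocket covariance comparison for the two monotone functionals `G(C x)` and `G(C x ∪ C o)` of the `{x,o}`-cluster
(prim-lf-2 gen-16/17 census: PCOV 0 / ≈ 7.6·10⁴, PCOV⁺ 0 / 1 332, (P1*D⁺) at the certificate point 0 / 1 196 exact instances, n ≤ 9;
neither PCOV nor PCOV⁺ is in the cone of the tree's covariance rows — the expected proof is a pocket version of prim-hp-8's COV(τ)
induction, whose averaging operator maps both functionals to functionals of `V(C x ∪ C o)`).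
[cite: KozmaNitzan2024, Questions 8–9 (§5.5 p. 36), display (41), §5.1 (pp. 31–32)] [cite: VandenbergHaggstromKahn2005, §2.1 Lemma 2.4 (p. 10), Thm. 2.1 (p. 9)]
-/

namespace Summit.CriticalPhenomena.PercolationContinuityZ3.Theorems

open MeasureTheory Set Literature.Probability.LatticeModels Literature.Probability.Percolation
open scoped Classical
open KNPreFKG

noncomputable section

namespace PocketCert

variable {V : Type*} [Fintype V]

/-- **(41) for three relays from the pocket covariance comparisons ALONE** (notation of `block41_three_of_pcov`; the weak-relay
hypothesis (Z*D) there is replaced by the set-cluster comparisons PCOV⁺_x, PCOV⁺_y, stated for every monotone `G` with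
`G(C x ∪ C o)` on the pocket events and `G(C x)` on the observer worlds).
[cite: KozmaNitzan2024, Questions 8–9 (§5.5 p. 36), display (41)] [cite: VandenbergHaggstromKahn2005, §2.1 Lemma 2.4 (p. 10), Thm. 2.1 (p. 9)] -/
theorem block41_three_of_pcovSet (w : Sym2 V → unitInterval) (o b x y z : V) (𝒟 : Set (Set V)) (h𝒟 : IsLowerSet 𝒟)
    (hx𝒟 : ∀ W ∈ 𝒟, x ∉ W) (hy𝒟 : ∀ W ∈ 𝒟, y ∉ W) (hz𝒟 : ∀ W ∈ 𝒟, z ∉ W) (t lam mu : ℝ) (ht0 : 0 ≤ t) (ht1 : t ≤ 1)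
    -- non-degeneracy of the pocket cells
    (hE1 : 0 < (prodBernoulli w).real ({ω : BondConfig V | openCluster ω o ∈ 𝒟} ∩
      ({ω | ¬ (openGraph ω).Reachable x y} ∩ {ω | ¬ (openGraph ω).Reachable x z})))
    (hE2 : 0 < (prodBernoulli w).real ({ω : BondConfig V | openCluster ω o ∈ 𝒟} ∩
      ({ω | ¬ (openGraph ω).Reachable y x} ∩ {ω | ¬ (openGraph ω).Reachable y z})))
    -- the certificate point
    (ht : t * ((prodBernoulli w).real (openConn x o ∩ {ω | ¬ (openGraph ω).Reachable x y} ∩ {ω | ¬ (openGraph ω).Reachable x z}) *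
          (prodBernoulli w).real ({ω : BondConfig V | openCluster ω o ∈ 𝒟} ∩
            ({ω | ¬ (openGraph ω).Reachable y x} ∩ {ω | ¬ (openGraph ω).Reachable y z})) +
        (prodBernoulli w).real (openConn y o ∩ {ω | ¬ (openGraph ω).Reachable y x} ∩ {ω | ¬ (openGraph ω).Reachable y z}) *
          (prodBernoulli w).real ({ω : BondConfig V | openCluster ω o ∈ 𝒟} ∩
            ({ω | ¬ (openGraph ω).Reachable x y} ∩ {ω | ¬ (openGraph ω).Reachable x z}))) =
      (prodBernoulli w).real (openConn x o ∩ {ω | ¬ (openGraph ω).Reachable x y} ∩ {ω | ¬ (openGraph ω).Reachable x z}) *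
        (prodBernoulli w).real ({ω : BondConfig V | openCluster ω o ∈ 𝒟} ∩
          ({ω | ¬ (openGraph ω).Reachable y x} ∩ {ω | ¬ (openGraph ω).Reachable y z})))
    (hlam : lam * (prodBernoulli w).real ({ω : BondConfig V | openCluster ω o ∈ 𝒟} ∩ {ω | ¬ (openGraph ω).Reachable x z}) =
      (prodBernoulli w).real (openConn x o ∩ {ω | ¬ (openGraph ω).Reachable x y} ∩ {ω | ¬ (openGraph ω).Reachable x z}) +
        t * (prodBernoulli w).real (openConn x o ∩ openConn x y ∩ {ω | ¬ (openGraph ω).Reachable x z}))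
    (hmu : mu * (prodBernoulli w).real ({ω : BondConfig V | openCluster ω o ∈ 𝒟} ∩ {ω | ¬ (openGraph ω).Reachable y z}) =
      (prodBernoulli w).real (openConn y o ∩ {ω | ¬ (openGraph ω).Reachable y x} ∩ {ω | ¬ (openGraph ω).Reachable y z}) +
        (1 - t) * (prodBernoulli w).real (openConn y o ∩ openConn y x ∩ {ω | ¬ (openGraph ω).Reachable y z}))
    -- PCOV, x-side, at `F = 1{b ∈ ·}`
    (hPx : (prodBernoulli w).real (openConn y o ∩ {ω | ¬ (openGraph ω).Reachable y x} ∩ {ω | ¬ (openGraph ω).Reachable y z}) *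
        ((prodBernoulli w).real ({ω : BondConfig V | openCluster ω o ∈ 𝒟} ∩
              ({ω | ¬ (openGraph ω).Reachable x y} ∩ {ω | ¬ (openGraph ω).Reachable x z})) *
            (prodBernoulli w).real ({ω : BondConfig V | openCluster ω o ∈ 𝒟} ∩
              (openConn x y ∩ {ω | ¬ (openGraph ω).Reachable x z}) ∩ openConn x b) -
          (prodBernoulli w).real ({ω : BondConfig V | openCluster ω o ∈ 𝒟} ∩
              (openConn x y ∩ {ω | ¬ (openGraph ω).Reachable x z})) *
            (prodBernoulli w).real ({ω : BondConfig V | openCluster ω o ∈ 𝒟} ∩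
              ({ω | ¬ (openGraph ω).Reachable x y} ∩ {ω | ¬ (openGraph ω).Reachable x z}) ∩ openConn x b)) ≤
      (prodBernoulli w).real ({ω : BondConfig V | openCluster ω o ∈ 𝒟} ∩
          ({ω | ¬ (openGraph ω).Reachable y x} ∩ {ω | ¬ (openGraph ω).Reachable y z})) *
        (((prodBernoulli w).real ({ω : BondConfig V | openCluster ω o ∈ 𝒟} ∩
                ({ω | ¬ (openGraph ω).Reachable x y} ∩ {ω | ¬ (openGraph ω).Reachable x z})) +
              (prodBernoulli w).real ({ω : BondConfig V | openCluster ω o ∈ 𝒟} ∩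
                (openConn x y ∩ {ω | ¬ (openGraph ω).Reachable x z}))) *
            ((prodBernoulli w).real (openConn x o ∩ {ω | ¬ (openGraph ω).Reachable x y} ∩ {ω | ¬ (openGraph ω).Reachable x z} ∩
                openConn x b) +
              (prodBernoulli w).real (openConn x o ∩ openConn x y ∩ {ω | ¬ (openGraph ω).Reachable x z} ∩ openConn x b)) -
          ((prodBernoulli w).real (openConn x o ∩ {ω | ¬ (openGraph ω).Reachable x y} ∩ {ω | ¬ (openGraph ω).Reachable x z}) +
              (prodBernoulli w).real (openConn x o ∩ openConn x y ∩ {ω | ¬ (openGraph ω).Reachable x z})) *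
            ((prodBernoulli w).real ({ω : BondConfig V | openCluster ω o ∈ 𝒟} ∩
                ({ω | ¬ (openGraph ω).Reachable x y} ∩ {ω | ¬ (openGraph ω).Reachable x z}) ∩ openConn x b) +
              (prodBernoulli w).real ({ω : BondConfig V | openCluster ω o ∈ 𝒟} ∩
                (openConn x y ∩ {ω | ¬ (openGraph ω).Reachable x z}) ∩ openConn x b))))
    -- PCOV, y-side, at `F = 1{b ∈ ·}`
    (hPy : (prodBernoulli w).real (openConn x o ∩ {ω | ¬ (openGraph ω).Reachable x y} ∩ {ω | ¬ (openGraph ω).Reachable x z}) *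
        ((prodBernoulli w).real ({ω : BondConfig V | openCluster ω o ∈ 𝒟} ∩
              ({ω | ¬ (openGraph ω).Reachable y x} ∩ {ω | ¬ (openGraph ω).Reachable y z})) *
            (prodBernoulli w).real ({ω : BondConfig V | openCluster ω o ∈ 𝒟} ∩
              (openConn y x ∩ {ω | ¬ (openGraph ω).Reachable y z}) ∩ openConn y b) -
          (prodBernoulli w).real ({ω : BondConfig V | openCluster ω o ∈ 𝒟} ∩
              (openConn y x ∩ {ω | ¬ (openGraph ω).Reachable y z})) *
            (prodBernoulli w).real ({ω : BondConfig V | openCluster ω o ∈ 𝒟} ∩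
              ({ω | ¬ (openGraph ω).Reachable y x} ∩ {ω | ¬ (openGraph ω).Reachable y z}) ∩ openConn y b)) ≤
      (prodBernoulli w).real ({ω : BondConfig V | openCluster ω o ∈ 𝒟} ∩
          ({ω | ¬ (openGraph ω).Reachable x y} ∩ {ω | ¬ (openGraph ω).Reachable x z})) *
        (((prodBernoulli w).real ({ω : BondConfig V | openCluster ω o ∈ 𝒟} ∩
                ({ω | ¬ (openGraph ω).Reachable y x} ∩ {ω | ¬ (openGraph ω).Reachable y z})) +
              (prodBernoulli w).real ({ω : BondConfig V | openCluster ω o ∈ 𝒟} ∩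
                (openConn y x ∩ {ω | ¬ (openGraph ω).Reachable y z}))) *
            ((prodBernoulli w).real (openConn y o ∩ {ω | ¬ (openGraph ω).Reachable y x} ∩ {ω | ¬ (openGraph ω).Reachable y z} ∩
                openConn y b) +
              (prodBernoulli w).real (openConn y o ∩ openConn y x ∩ {ω | ¬ (openGraph ω).Reachable y z} ∩ openConn y b)) -
          ((prodBernoulli w).real (openConn y o ∩ {ω | ¬ (openGraph ω).Reachable y x} ∩ {ω | ¬ (openGraph ω).Reachable y z}) +
              (prodBernoulli w).real (openConn y o ∩ openConn y x ∩ {ω | ¬ (openGraph ω).Reachable y z})) *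
            ((prodBernoulli w).real ({ω : BondConfig V | openCluster ω o ∈ 𝒟} ∩
                ({ω | ¬ (openGraph ω).Reachable y x} ∩ {ω | ¬ (openGraph ω).Reachable y z}) ∩ openConn y b) +
              (prodBernoulli w).real ({ω : BondConfig V | openCluster ω o ∈ 𝒟} ∩
                (openConn y x ∩ {ω | ¬ (openGraph ω).Reachable y z}) ∩ openConn y b))))
    -- PCOV⁺, x-side, every monotone `G`: `G(C x ∪ C o)` on the pocket events
    (hPxs : ∀ G : Set V → ℝ, (∀ S T : Set V, S ⊆ T → G S ≤ G T) →
      (prodBernoulli w).real (openConn y o ∩ {ω | ¬ (openGraph ω).Reachable y x} ∩ {ω | ¬ (openGraph ω).Reachable y z}) *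
        ((prodBernoulli w).real ({ω : BondConfig V | openCluster ω o ∈ 𝒟} ∩
              ({ω | ¬ (openGraph ω).Reachable x y} ∩ {ω | ¬ (openGraph ω).Reachable x z})) *
            (∫ ω in {ω : BondConfig V | openCluster ω o ∈ 𝒟} ∩ (openConn x y ∩ {ω | ¬ (openGraph ω).Reachable x z}),
              G (openCluster ω x ∪ openCluster ω o) ∂(prodBernoulli w)) -
          (prodBernoulli w).real ({ω : BondConfig V | openCluster ω o ∈ 𝒟} ∩
              (openConn x y ∩ {ω | ¬ (openGraph ω).Reachable x z})) *
            (∫ ω in {ω : BondConfig V | openCluster ω o ∈ 𝒟} ∩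
              ({ω | ¬ (openGraph ω).Reachable x y} ∩ {ω | ¬ (openGraph ω).Reachable x z}),
              G (openCluster ω x ∪ openCluster ω o) ∂(prodBernoulli w))) ≤
      (prodBernoulli w).real ({ω : BondConfig V | openCluster ω o ∈ 𝒟} ∩
          ({ω | ¬ (openGraph ω).Reachable y x} ∩ {ω | ¬ (openGraph ω).Reachable y z})) *
        ((((prodBernoulli w).real ({ω : BondConfig V | openCluster ω o ∈ 𝒟} ∩
                ({ω | ¬ (openGraph ω).Reachable x y} ∩ {ω | ¬ (openGraph ω).Reachable x z})) +
              (prodBernoulli w).real ({ω : BondConfig V | openCluster ω o ∈ 𝒟} ∩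
                (openConn x y ∩ {ω | ¬ (openGraph ω).Reachable x z}))) *
            ((∫ ω in openConn x o ∩ {ω | ¬ (openGraph ω).Reachable x y} ∩ {ω | ¬ (openGraph ω).Reachable x z},
                G (openCluster ω x) ∂(prodBernoulli w)) +
              ∫ ω in openConn x o ∩ openConn x y ∩ {ω | ¬ (openGraph ω).Reachable x z},
                G (openCluster ω x) ∂(prodBernoulli w))) -
          ((prodBernoulli w).real (openConn x o ∩ {ω | ¬ (openGraph ω).Reachable x y} ∩ {ω | ¬ (openGraph ω).Reachable x z}) +
              (prodBernoulli w).real (openConn x o ∩ openConn x y ∩ {ω | ¬ (openGraph ω).Reachable x z})) *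
            ((∫ ω in {ω : BondConfig V | openCluster ω o ∈ 𝒟} ∩
                ({ω | ¬ (openGraph ω).Reachable x y} ∩ {ω | ¬ (openGraph ω).Reachable x z}),
                G (openCluster ω x ∪ openCluster ω o) ∂(prodBernoulli w)) +
              ∫ ω in {ω : BondConfig V | openCluster ω o ∈ 𝒟} ∩ (openConn x y ∩ {ω | ¬ (openGraph ω).Reachable x z}),
                G (openCluster ω x ∪ openCluster ω o) ∂(prodBernoulli w))))
    -- PCOV⁺, y-side, every monotone `G`
    (hPys : ∀ G : Set V → ℝ, (∀ S T : Set V, S ⊆ T → G S ≤ G T) →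
      (prodBernoulli w).real (openConn x o ∩ {ω | ¬ (openGraph ω).Reachable x y} ∩ {ω | ¬ (openGraph ω).Reachable x z}) *
        ((prodBernoulli w).real ({ω : BondConfig V | openCluster ω o ∈ 𝒟} ∩
              ({ω | ¬ (openGraph ω).Reachable y x} ∩ {ω | ¬ (openGraph ω).Reachable y z})) *
            (∫ ω in {ω : BondConfig V | openCluster ω o ∈ 𝒟} ∩ (openConn y x ∩ {ω | ¬ (openGraph ω).Reachable y z}),
              G (openCluster ω y ∪ openCluster ω o) ∂(prodBernoulli w)) -
          (prodBernoulli w).real ({ω : BondConfig V | openCluster ω o ∈ 𝒟} ∩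
              (openConn y x ∩ {ω | ¬ (openGraph ω).Reachable y z})) *
            (∫ ω in {ω : BondConfig V | openCluster ω o ∈ 𝒟} ∩
              ({ω | ¬ (openGraph ω).Reachable y x} ∩ {ω | ¬ (openGraph ω).Reachable y z}),
              G (openCluster ω y ∪ openCluster ω o) ∂(prodBernoulli w))) ≤
      (prodBernoulli w).real ({ω : BondConfig V | openCluster ω o ∈ 𝒟} ∩
          ({ω | ¬ (openGraph ω).Reachable x y} ∩ {ω | ¬ (openGraph ω).Reachable x z})) *
        ((((prodBernoulli w).real ({ω : BondConfig V | openCluster ω o ∈ 𝒟} ∩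
                ({ω | ¬ (openGraph ω).Reachable y x} ∩ {ω | ¬ (openGraph ω).Reachable y z})) +
              (prodBernoulli w).real ({ω : BondConfig V | openCluster ω o ∈ 𝒟} ∩
                (openConn y x ∩ {ω | ¬ (openGraph ω).Reachable y z}))) *
            ((∫ ω in openConn y o ∩ {ω | ¬ (openGraph ω).Reachable y x} ∩ {ω | ¬ (openGraph ω).Reachable y z},
                G (openCluster ω y) ∂(prodBernoulli w)) +
              ∫ ω in openConn y o ∩ openConn y x ∩ {ω | ¬ (openGraph ω).Reachable y z},
                G (openCluster ω y) ∂(prodBernoulli w))) -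
          ((prodBernoulli w).real (openConn y o ∩ {ω | ¬ (openGraph ω).Reachable y x} ∩ {ω | ¬ (openGraph ω).Reachable y z}) +
              (prodBernoulli w).real (openConn y o ∩ openConn y x ∩ {ω | ¬ (openGraph ω).Reachable y z})) *
            ((∫ ω in {ω : BondConfig V | openCluster ω o ∈ 𝒟} ∩
                ({ω | ¬ (openGraph ω).Reachable y x} ∩ {ω | ¬ (openGraph ω).Reachable y z}),
                G (openCluster ω y ∪ openCluster ω o) ∂(prodBernoulli w)) +
              ∫ ω in {ω : BondConfig V | openCluster ω o ∈ 𝒟} ∩ (openConn y x ∩ {ω | ¬ (openGraph ω).Reachable y z}),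
                G (openCluster ω y ∪ openCluster ω o) ∂(prodBernoulli w))))
    -- the pocket designation of `z`
    (hzx : (prodBernoulli w).real ({ω : BondConfig V | openCluster ω o ∈ 𝒟} ∩ openConn z b) ≤
      (prodBernoulli w).real ({ω : BondConfig V | openCluster ω o ∈ 𝒟} ∩ openConn x b))
    (hzy : (prodBernoulli w).real ({ω : BondConfig V | openCluster ω o ∈ 𝒟} ∩ openConn z b) ≤
      (prodBernoulli w).real ({ω : BondConfig V | openCluster ω o ∈ 𝒟} ∩ openConn y b)) :
    (prodBernoulli w).real (openConn z b ∩ (openConn o x ∪ openConn o y ∪ openConn o z)) ≤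
      (prodBernoulli w).real (openConn o b ∩ (openConn o x ∪ openConn o y ∪ openConn o z)) := by
  classical
  set μ := prodBernoulli w with hμ
  have hmeas : ∀ S : Set (BondConfig V), MeasurableSet S := fun _ => MeasurableSet.of_discrete
  have hn := fun (S : Set (BondConfig V)) => (measureReal_nonneg : 0 ≤ μ.real S)
  have hint : ∀ (g : BondConfig V → ℝ) (S : Set (BondConfig V)), IntegrableOn g S μ :=
    fun g S => (Integrable.of_finite).integrableOn
  set P : Set (BondConfig V) := {ω : BondConfig V | openCluster ω o ∈ 𝒟} with hP
  set E1x : Set (BondConfig V) := {ω : BondConfig V | ¬ (openGraph ω).Reachable x y} ∩ {ω | ¬ (openGraph ω).Reachable x z} with hE1x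
  set Fx : Set (BondConfig V) := openConn x y ∩ {ω : BondConfig V | ¬ (openGraph ω).Reachable x z} with hFx
  set E2y : Set (BondConfig V) := {ω : BondConfig V | ¬ (openGraph ω).Reachable y x} ∩ {ω | ¬ (openGraph ω).Reachable y z} with hE2y
  set Fy : Set (BondConfig V) := openConn y x ∩ {ω : BondConfig V | ¬ (openGraph ω).Reachable y z} with hFy
  set W1 : Set (BondConfig V) := openConn x o ∩ {ω | ¬ (openGraph ω).Reachable x y} ∩ {ω | ¬ (openGraph ω).Reachable x z} with hW1
  set W2 : Set (BondConfig V) := openConn y o ∩ {ω | ¬ (openGraph ω).Reachable y x} ∩ {ω | ¬ (openGraph ω).Reachable y z} with hW2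
  set W3x : Set (BondConfig V) := openConn x o ∩ openConn x y ∩ {ω | ¬ (openGraph ω).Reachable x z} with hW3x
  set W3y : Set (BondConfig V) := openConn y o ∩ openConn y x ∩ {ω | ¬ (openGraph ω).Reachable y z} with hW3y
  -- the pocket cells partition `P ∩ {x ↮ z}` resp. `P ∩ {y ↮ z}` (for integrals)
  have splitx : ∀ g : BondConfig V → ℝ, ∫ ω in P ∩ {ω | ¬ (openGraph ω).Reachable x z}, g ω ∂μ =
      (∫ ω in P ∩ E1x, g ω ∂μ) + ∫ ω in P ∩ Fx, g ω ∂μ := by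
    intro g
    have hdj : Disjoint (P ∩ E1x) (P ∩ Fx) := by
      rw [Set.disjoint_left]
      rintro ω ⟨-, hxy, -⟩ ⟨-, hxy', -⟩
      exact hxy hxy'
    have hset : P ∩ {ω | ¬ (openGraph ω).Reachable x z} = (P ∩ E1x) ∪ (P ∩ Fx) := by
      ext ω
      simp only [hE1x, hFx, mem_inter_iff, mem_union, mem_setOf_eq, openConn]
      tauto
    rw [hset, setIntegral_union hdj (hmeas _) (hint _ _) (hint _ _)]
  have splity : ∀ g : BondConfig V → ℝ, ∫ ω in P ∩ {ω | ¬ (openGraph ω).Reachable y z}, g ω ∂μ =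
      (∫ ω in P ∩ E2y, g ω ∂μ) + ∫ ω in P ∩ Fy, g ω ∂μ := by
    intro g
    have hdj : Disjoint (P ∩ E2y) (P ∩ Fy) := by
      rw [Set.disjoint_left]
      rintro ω ⟨-, hyx, -⟩ ⟨-, hyx', -⟩
      exact hyx hyx'
    have hset : P ∩ {ω | ¬ (openGraph ω).Reachable y z} = (P ∩ E2y) ∪ (P ∩ Fy) := by
      ext ω
      simp only [hE2y, hFy, mem_inter_iff, mem_union, mem_setOf_eq, openConn]
      tauto
    rw [hset, setIntegral_union hdj (hmeas _) (hint _ _) (hint _ _)]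
  have massx : μ.real (P ∩ {ω | ¬ (openGraph ω).Reachable x z}) = μ.real (P ∩ E1x) + μ.real (P ∩ Fx) := by
    have h := splitx (fun _ => (1 : ℝ))
    simpa only [setIntegral_const, smul_eq_mul, mul_one, Measure.real] using h
  have massy : μ.real (P ∩ {ω | ¬ (openGraph ω).Reachable y z}) = μ.real (P ∩ E2y) + μ.real (P ∩ Fy) := by
    have h := splity (fun _ => (1 : ℝ))
    simpa only [setIntegral_const, smul_eq_mul, mul_one, Measure.real] using h
  have hlam' : lam * (μ.real (P ∩ E1x) + μ.real (P ∩ Fx)) = μ.real W1 + t * μ.real W3x := by rw [← massx]; exact hlam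
  have hmu' : mu * (μ.real (P ∩ E2y) + μ.real (P ∩ Fy)) = μ.real W2 + (1 - t) * μ.real W3y := by rw [← massy]; exact hmu
  have ht' : (1 - t) * (μ.real W2 * μ.real (P ∩ E1x) + μ.real W1 * μ.real (P ∩ E2y)) = μ.real W2 * μ.real (P ∩ E1x) := by
    linear_combination (-1 : ℝ) * ht
  -- the set-cluster observer halves (P1*D⁺), (P2*D⁺) for every monotone `G`
  have hP1 : ∀ G : Set V → ℝ, (∀ S T : Set V, S ⊆ T → G S ≤ G T) →
      lam * ∫ ω in P ∩ {ω | ¬ (openGraph ω).Reachable x z}, G (openCluster ω x ∪ openCluster ω o) ∂μ ≤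
        (∫ ω in W1, G (openCluster ω x) ∂μ) + t * ∫ ω in W3x, G (openCluster ω x) ∂μ := by
    intro G hG
    have hB := attach_of_pocket_union w o x y z 𝒟 h𝒟 hy𝒟 hz𝒟 G hG
    have h := p1star_pocket_of_pieces (∫ ω in W1, G (openCluster ω x) ∂μ) (∫ ω in W3x, G (openCluster ω x) ∂μ)
      (∫ ω in P ∩ E1x, G (openCluster ω x ∪ openCluster ω o) ∂μ) (∫ ω in P ∩ Fx, G (openCluster ω x ∪ openCluster ω o) ∂μ)
      (μ.real W1) (μ.real W3x) (μ.real W2) (μ.real (P ∩ E1x)) (μ.real (P ∩ Fx)) (μ.real (P ∩ E2y)) t lam ht0 ht1 hE1 hE2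
      (hn _) ht hlam' hB (hPxs G hG)
    rw [splitx]; exact h
  have hP2 : ∀ G : Set V → ℝ, (∀ S T : Set V, S ⊆ T → G S ≤ G T) →
      mu * ∫ ω in P ∩ {ω | ¬ (openGraph ω).Reachable y z}, G (openCluster ω y ∪ openCluster ω o) ∂μ ≤
        (∫ ω in W2, G (openCluster ω y) ∂μ) + (1 - t) * ∫ ω in W3y, G (openCluster ω y) ∂μ := by
    intro G hG
    have hB := attach_of_pocket_union w o y x z 𝒟 h𝒟 hx𝒟 hz𝒟 G hG
    have h := p1star_pocket_of_pieces (∫ ω in W2, G (openCluster ω y) ∂μ) (∫ ω in W3y, G (openCluster ω y) ∂μ)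
      (∫ ω in P ∩ E2y, G (openCluster ω y ∪ openCluster ω o) ∂μ) (∫ ω in P ∩ Fy, G (openCluster ω y ∪ openCluster ω o) ∂μ)
      (μ.real W2) (μ.real W3y) (μ.real W1) (μ.real (P ∩ E2y)) (μ.real (P ∩ Fy)) (μ.real (P ∩ E1x)) (1 - t) mu
      (by linarith) (by linarith) hE2 hE1 (hn _) ht' hmu' hB (hPys G hG)
    rw [splity]; exact h
  -- (Z*D) at `F = 1{b ∈ ·}` by duality through the set clusters
  set F : Set V → ℝ := fun T => T.indicator (1 : V → ℝ) b with hF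
  have hFmono : ∀ S T : Set V, S ⊆ T → F S ≤ F T := by
    intro S T hST
    simp only [hF]
    by_cases hb : b ∈ S
    · rw [indicator_of_mem hb, indicator_of_mem (hST hb)]
    · rw [indicator_of_notMem hb]
      by_cases hb' : b ∈ T
      · rw [indicator_of_mem hb']; simp
      · rw [indicator_of_notMem hb']
  have hI : ∀ (v : V) (S : Set (BondConfig V)), ∫ ω in S, F (openCluster ω v) ∂μ = μ.real (S ∩ openConn v b) :=
    fun v S => setIntegral_indicator_openCluster μ b v S
  have hZ := zpart_of_setHalves w o x y z 𝒟 hz𝒟 F hFmono t lam mu hP1 hP2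
  rw [hI, hI, hI] at hZ
  exact block41_three_of_pcov w o b x y z 𝒟 h𝒟 hx𝒟 hy𝒟 hz𝒟 t lam mu ht0 ht1 hE1 hE2 ht hlam hmu hPx hPy hZ hzx hzy

end PocketCert

end

end Summit.CriticalPhenomena.PercolationContinuityZ3.Theorems
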